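import Summits.BirchSwinnertonDyer.Rank1Residual.Supersingular.SharpFlatRankZero
import Summits.BirchSwinnertonDyer.Rank1Residual.X4.KuriharaClasswide
import HarnessLib

/-!
# Class X8 (`p = 3`, `a_3 = ±3`), analytic rank `0`: the per-pair KURIHARA-NUMBER route into the
# ♯/♭ chain — `BSD(E,3)` from one unit mod-3 Kurihara number, with every input named
# (cell `b2b-bsdres`, supersingular family, prover B = unit `b2b-bsdres-additive-p3`, gen 2)

HONEST FRAMING (run/shared/lean/b2b/bsd-rank1-residual/, verbatim in every file): the goal of the
cell is to DELETE the COMBINATION-SHAPED residual classes of the Birch–Swinnerton-Dyer formula for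
ALL analytic-rank `≤ 1` elliptic curves over `ℚ` — "full BSD formula for every rank `≤ 1` curve in
class `C`" assembled STRICTLY from published theorems — so that the rank-`≤ 1` remainder becomes
exactly the CONSTRUCTION-SHAPED classes, which are TYPED (missing-input `Prop`s), NOT attempted.
This is not "finishing BSD". Research route; no claim beyond the stated classes. X8 stays
CONSTRUCTION-SHAPED; per pair only; nothing about any curve is asserted; nothing is booked.
Theorems only (compositions of tree theorems); no new definition, no named fact.

## What this module is (the coordinator's brief for prover B: "r = 0 per pair via Kim/Kurihara
## certificates where surj(3) — your KuriharaClasswide machinery transplants")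

On X3/X4 (additive `p ≥ 5`) the unit `b2b-bsdres-additive-p3` typed the per-pair input of C.-H. Kim's
Kurihara-number route as `X4.KuriharaUnitAt W p f` ("some mod-`p` Kurihara number `δ̃_n` at a cyclic
Kolyvagin level is a unit", `X4/KuriharaClasswide.lean`, p199308) and consumed it through Kim, Amer.
J. Math. 148 (2026) Thm. 1.8 (6). THAT consumer does NOT transplant to X8: Kim's theorem carries
`p ≥ 5` (Mazur–Rubin (H.4b); Kim §1.2.5). What DOES reach `p = 3` in print, at statement level, is
Kim–Kim–Sun, Selecta Math. 26 (2020) **Thm. 1.1** [corpus: paper:arxiv-1709.05780 p0004]: "Assume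
(NA) `a_p(f) ≢ 1 (mod λ)` and `a_p(f) ≢ ψ(p) (mod λ)`; (Im) the image of `ρ̄` contains a conjugate
of `SL₂(𝔽_p)`; (Tam) … . If `δ̃_n ≠ 0 ∈ 𝔽_λ` for some `n`, then … the Iwasawa main conjecture à la
Kato (Conjecture 2.?) holds for `(f, ℚ_∞/ℚ)`" — standing hypothesis "Let `p > 2` be a prime"
(p0003 L39), any good prime, the paper's own §8.2.2 being a `p = 3` good SUPERSINGULAR `a_3 = 3`
example (conductor 760). On X8: (NA) is AUTOMATIC (`a_3 = ±3 ≡ 0`, trivial nebentypus `ψ(3) = 1`: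
`ClassX8.not_anomalous` below), (Im) ⇐ surj(3), (Tam) is per pair. Combined with Sprung, J. Number
Theory 132 (2012) **Prop. 7.19 / Main Conj. 7.21** ("In view of Proposition 7.19, the following
conjecture is equivalent to the main conjecture of Kato", p. 1505), a unit `δ̃_n` at `(E, 3)` gives
the ♯/♭ main conjecture, in particular (MC↓) `L^• ∣ ξ^•` for Sprung's datum — the ONE open input of
`X8.bsdp_of_signedLowerDivisibility_of_surj_of_analyticRank_eq_zero` (p207337), whose other inputs
are all in refereed print since gen 2's read of Sprung, Adv. Math. 449 (2024) Lemmas 5.5–5.9 ((K•);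
`SignedSqueeze.lean`, p208039). The bridge "unit `δ̃_n` at a cyclic Kolyvagin level (tree
normalisation `Ω⁺_f`, `kuriharaNumber`) ⇒ (MC↓) for the datum" is DISPLAYED as the binder `hKKS`
(KKS Thm. 1.1 ∘ Sprung Prop. 7.19; shape, nothing asserted) — it is NOT a named fact because
(i) FLAG `KKS20@3-MR-H4`: KKS Lemma 4.3 takes Mazur–Rubin's (H.1)–(H.4) from (Im), and at `p = 3`
(H.4) ("`Hom(T̄, T̄^*(1)) = 0` or `p > 4`") fails for the self-dual `E[3]` (Mazur–Rubin: "`p > 3` is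
only used for choosing useful primes", quoted by Sakamoto, Doc. Math. 27 (2022) App. A, which
repairs that choice at `p = 3` in his rank-`0` setting only); (ii) the tree has no vocabulary for
Kato's main conjecture at a supersingular prime (`H¹_Iw`, fine Selmer, zeta elements) nor for the
♯/♭ objects, so neither KKS's conclusion nor Prop. 7.19 can be stated verbatim yet; (iii) KKS
normalise `[a/n]⁺` by the integral canonical period `Ω_f^{can}` (mod-`p` multiplicity one, §5), the
tree by `Ω⁺_f` — a `p`-adic unit apart under (Im) for an optimal curve with Manin constant prime to
`p`, part of what the binder displays. A referee ruling (R-X8: KKS@3) decides bookability; the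
lane's job "δ̃_{ℓ₁ℓ₂} mod 3 at ν = 2 for the 52 ‖ 19 rank-0 X8 core pairs" (X8-ROUTE-B §2(d)) would
supply `hunit` per pair (δ̃_1 = L(E,1)/Ω⁺ ≡ 0 there since `9 ∣ #Ш_an`, so ν = 2 is the first level).
These same pairs are ALSO decided by ONE descent bit (`Ш(E)[3] ≠ 0` ⇒ `9 ∣ #Ш` by Cassels–Tate ⇒
equality with Wuthrich's bound; sha-2 tier T-full3) — the route here is a second, IMC-based one.

Contents: `ClassX8.not_anomalous` ((NA) on X8: `¬ 3 ∣ a_3 − 1`), `X8.bsdp_of_kuriharaUnitAt_of_kksBridge_of_analyticRank_eq_zero`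
(X8 ∧ r_an = 0 ∧ surj(3): Wuthrich + (K•)(P•), `3 ∤ c` + bridge + unit `δ̃_n` ⇒ `BSDp W p`),
`…_of_semistable_…` (surj automatic), `X8.missingInputAt_of_kuriharaUnitAt_of_kksBridge` (typed currency).

References: Kim–Kim–Sun, Selecta Math. (N.S.) 26 (2020) Thm. 1.1, Lemma 4.3, §8.2.2 [KimKimSun2020];
Sprung, J. Number Theory 132 (2012) Prop. 7.19, Main Conj. 7.21 (p. 1505) [Sprung2012]; Sprung, Adv.
Math. 449 (2024) Lemmas 5.5–5.9 [Sprung2024]; Kim, Amer. J. Math. 148 (2026) Thm. 1.8, §1.2.5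
[Kim2022StructureSelmer]; Sakamoto, Doc. Math. 27 (2022) App. A [Sakamoto2022pSelmer]; Wuthrich, Doc.
Math. 19 (2014) Prop. 21 [Wuthrich2014]; Serre 1972 Props. 12, 21 [Serre1972]; Miller 2011 Def. 1.1
[Miller2011LMS]; memo HOME/b2b-bsdres-additive-p3/X8-ROUTE-B.md §2, §6.
-/

set_option autoImplicit false

noncomputable section

open scoped Classical MatrixGroups ModularForm

open CongruenceSubgroup WeierstrassCurve Literature.NumberTheory.EllipticCurves
  Literature.NumberTheory.EllipticCurves.ModularForms
  Literature.NumberTheory.EllipticCurves.Rank1Residual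
  Literature.NumberTheory.EllipticCurves.Rank1Residual.Typed

namespace Summit.BirchSwinnertonDyer.Rank1Residual.Supersingular

variable (W : WeierstrassCurve ℚ) [W.IsElliptic] [W.IsGloballyMinimal] (p : ℕ) [Fact p.Prime]

omit [W.IsElliptic] in
/-- **(NA) on X8**: at an X8 pair `a_3 ≢ 1 (mod 3)` — indeed `3 ∣ a_3` (good supersingular at `3`),
so `3 ∣ a_3 − 1` would give `3 ∣ 1`. This is Kim–Kim–Sun's non-anomalous hypothesis (NA) (with trivial
nebentypus both clauses read `a_p ≢ 1`), automatic on the class. [cite: KimKimSun2020, Thm. 1.1 hypothesis (NA)] -/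
theorem ClassX8.not_anomalous (hX : ClassX8 W p) : ¬ (3 : ℤ) ∣ W.frobeniusTrace 3 - 1 := by
  obtain ⟨-, ⟨-, h3⟩, -⟩ := hX
  intro h
  have h1 : (3 : ℤ) ∣ 1 := by
    have h' := dvd_sub h3 h
    simp at h'
  omega

/-- **X8 ∧ `r_an = 0` ∧ surj(3): `BSD(E,3)` from ONE unit mod-3 Kurihara number, every other input
named.** Granted Wuthrich 2014 Prop. 21 (`hW`, PUB upper bound), GZK, modularity; a chromatic datum
`D = (ξ^•, L^•, c^•)` with (K•) [Sprung 2024 Lemmas 5.5–5.9, PUB], (P•) [Sprung 2012 §6, PUB] and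
`3 ∤ c`; a newform `f` of `W` (`hf`); the DISPLAYED bridge `hKKS` — "a unit Kurihara number at a cyclic
Kolyvagin level for `(E,3)` gives the Eisenstein divisibility `L^• ∣ ξ^•`" = Kim–Kim–Sun 2020 Thm. 1.1
((NA) automatic: `ClassX8.not_anomalous`; (Im) ⇐ `hs`; (Tam) per pair) ∘ Sprung 2012 Prop. 7.19 (Kato
⟺ ♯/♭), shape only, flag `KKS20@3-MR-H4` —; and the certificate `hunit : KuriharaUnitAt W 3 f` (the
lane's two-engine mod-3 `δ̃_n`): then Miller's `BSD(E,3)`, through p207337's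
`X8.bsdp_of_signedLowerDivisibility_of_surj_of_analyticRank_eq_zero`. Per pair; NOT a class theorem.
[cite: KimKimSun2020, Thm. 1.1 and §8.2.2] [cite: Sprung2012, Prop. 7.19 and Main Conj. 7.21 (p. 1505)]
[cite: Sprung2024, Lemmas 5.5–5.9 (pp. 40–41)] [cite: Wuthrich2014, Prop. 21 (p. 400)] [cite: Miller2011LMS, Def. 1.1] -/
theorem X8.bsdp_of_kuriharaUnitAt_of_kksBridge_of_analyticRank_eq_zero
    (hW : Wuthrich2014.sha_dvd_analyticSha)
    (hGZK : rank_eq_analyticRank_of_analyticRank_le_one) (hmod : hasEntireLFunction_rat)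
    (hX : ClassX8 W p) (hs : Surj W p) (h0 : W.analyticRank = 0)
    (D : SignedDatum W p) (hc : ¬ p ∣ D.c) (hK : D.EulerCharacteristic) (hP : D.Interpolation)
    {N : ℕ} [NeZero N] (f : CuspForm (Gamma0 N) 2) (hf : IsNewformOf W f)
    (hKKS : IsNewformOf W f → ¬ (3 : ℤ) ∣ W.frobeniusTrace 3 - 1 → Surj W p →
      X4.KuriharaUnitAt W p f → D.LowerDivisibility)
    (hunit : X4.KuriharaUnitAt W p f) : BSDp W p :=
  X8.bsdp_of_signedLowerDivisibility_of_surj_of_analyticRank_eq_zero W p hW hGZK hmod hX hs h0 D hc hK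
    hP (hKKS hf (ClassX8.not_anomalous W p hX) hs hunit)

/-- **X8 ∩ {sst} ∧ `r_an = 0`**: the same with `ρ̄_{E,3}` onto automatic for semistable `E`
(`ClassX8.surj_of_semistable`, Serre 1972 Prop. 21 i)). Per pair; NOT a class theorem.
[cite: Serre1972, §5.4 Prop. 21 i)] [cite: KimKimSun2020, Thm. 1.1] [cite: Sprung2012, Prop. 7.19 (p. 1505)]
[cite: Wuthrich2014, Prop. 21 (p. 400)] [cite: Miller2011LMS, Def. 1.1] -/
theorem X8.bsdp_of_kuriharaUnitAt_of_kksBridge_of_semistable_of_analyticRank_eq_zero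
    (hW : Wuthrich2014.sha_dvd_analyticSha)
    (hGZK : rank_eq_analyticRank_of_analyticRank_le_one) (hmod : hasEntireLFunction_rat)
    (hX : ClassX8 W p) (hsst : Semistable W) (h0 : W.analyticRank = 0)
    (D : SignedDatum W p) (hc : ¬ p ∣ D.c) (hK : D.EulerCharacteristic) (hP : D.Interpolation)
    {N : ℕ} [NeZero N] (f : CuspForm (Gamma0 N) 2) (hf : IsNewformOf W f)
    (hKKS : IsNewformOf W f → ¬ (3 : ℤ) ∣ W.frobeniusTrace 3 - 1 → Surj W p →
      X4.KuriharaUnitAt W p f → D.LowerDivisibility)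
    (hunit : X4.KuriharaUnitAt W p f) : BSDp W p := by
  have hs : Surj W 3 := ClassX8.surj_of_semistable W p hX hsst
  have hp3 : p = 3 := hX.1
  subst hp3
  exact X8.bsdp_of_kuriharaUnitAt_of_kksBridge_of_analyticRank_eq_zero W 3 hW hGZK hmod hX hs h0 D hc
    hK hP f hf hKKS hunit

/-- **Bookkeeping into the typed currency**: the same inputs deliver `X8.MissingInputAt W p`
(`Typed/X8.lean`; in rank `0` with surj(3) it IS the lower bound). [cite: KimKimSun2020, Thm. 1.1]
[cite: Sprung2012, Prop. 7.19 (p. 1505)] [cite: Miller2011LMS, Def. 1.1] -/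
theorem X8.missingInputAt_of_kuriharaUnitAt_of_kksBridge
    (hGZK : rank_eq_analyticRank_of_analyticRank_le_one) (hmod : hasEntireLFunction_rat)
    (hX : ClassX8 W p) (hs : Surj W p) (h0 : W.analyticRank = 0)
    (D : SignedDatum W p) (hc : ¬ p ∣ D.c) (hK : D.EulerCharacteristic) (hP : D.Interpolation)
    {N : ℕ} [NeZero N] (f : CuspForm (Gamma0 N) 2) (hf : IsNewformOf W f)
    (hKKS : IsNewformOf W f → ¬ (3 : ℤ) ∣ W.frobeniusTrace 3 - 1 → Surj W p →
      X4.KuriharaUnitAt W p f → D.LowerDivisibility)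
    (hunit : X4.KuriharaUnitAt W p f) : X8.MissingInputAt W p :=
  X8.missingInputAt_of_signedLowerDivisibility_of_surj W p hGZK hmod hX hs h0 D hc hK hP
    (hKKS hf (ClassX8.not_anomalous W p hX) hs hunit)

end Summit.BirchSwinnertonDyer.Rank1Residual.Supersingular

end
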